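import Mathlib.Data.Fintype.Pigeonhole
import Mathlib.Data.Set.Finite.Lattice
import Mathlib.Algebra.Order.BigOperators.Group.Finset
import Mathlib.Tactic
import HarnessLib
import HarnessLib.Audit.Tags

/-!
# Purely inseparable four-folds — the C∞ GAME (frame-free): NO INFINITE LEGAL DOUBLY-FLAGGED PLAY
# (cell `res-dim4-pi`, K2(p) lane, slice B brick K24b-α)

[OURS · counted 0 · cell `res-dim4-pi` · K2(p) lane holder res-dim4-p-12 g3's brick by signature (bus
2026-08-29 01:52Z); game and tables res-dim4-idea-4 g3 (00:46Z); uniform rule, model check and trajectory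
proof res-dim4-p-9 g3 (01:57Z / 02:40Z); seat res-dim4-p-9 g3.]  Nothing here proves K2(p)/K2(5),
`NoIsolatedTrap p p` or resolution of singularities in dimension ≥ 4 / characteristic `p`; this is the
combinatorial game of I-4-7's class C∞ (`d = 4`, two boundary letters `λ, μ`), stated WITHOUT polynomials and
WITHOUT definitions, for res-dim4-typ-1's frame file to instantiate.

THE UNIFORM RULE.  idea-4's four families `B₀, B₁ ⊂ ℕ²`, `S₁, S₂ ⊂ ℕ³` and their tables are ONE rule with a
family constant `c` (`B₀: c = 3`, `B₁: c = 2`, `S₁: c = 2`, `S₂: c = 1`); a monomial is `m = (c, a, b, e)`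
(`x_λ^a x_μ^b ū^e`; `e = 0` for the `B`'s), written `(m.1, m.2.1, m.2.2.1, m.2.2.2)`:
* λ-STEP `(c, a, b, e) ↦ (c, a + b + e − c, b, e)`; μ-STEP `(c, a, b, e) ↦ (c, a, a + b + e − c, e)`;
* LEGAL(λ) ⟺ no monomial present is a λ-BLOCKER `a + 2b + 2e < 2c` (these are exactly the table entries
  `B₀ ∌ x_λ³, x_λ⁴, x_λ⁵, x_λ²x_μ, x_λ³x_μ, x_λx_μ²`, `B₁ ∌ x_λ², x_λ³, x_λx_μ`, …, i.e. the monomials whose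
  λ-image breaks the order `c ≤ a + b + e`); LEGAL(μ) ⟺ nobody has `2a + b + 2e < 2c`;
* λ-FLAG ⟺ some monomial present is a λ-WITNESS `b + e + 1 ≤ c` (`B₀ ⊄ (x_μ³)`, `B₁ ⊄ (x_μ²)`,
  `S₁ ⊄ (x_μ, ū)²`, `S₂ ⊄ (x_μ, ū)`); μ-FLAG ⟺ somebody has `a + e + 1 ≤ c`.
A PLAY along a word `x : ℕ → Bool` (`true = λ`) is a sequence of supports `P t` (predicates on `ℕ⁴`) such
that every monomial present at time `t + 1` is the `x t`-image of one present at time `t` OR is born DEAD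
(`c ≤ a + e ∧ c ≤ b + e`: the cleaning / re-straightening noise of the frame lives there, res-dim4-idea-4 g4
(R1)) — sub-image: cancellations / deletions allowed — from a FINITE initial support; no bound on `c`.
**FRAME OBLIGATION (idea-4 g4 (R2)): `F : Finset` = finiteness of the (non-dead) initial support is a GENUINE
hypothesis** — sound for a polynomial frame, NOT dischargeable by a total-degree jet of a power-series frame
(for series use the exact-transport variant); with the sub-image law it is also NECESSARY (by hand:
`B₀ ⊇ {x_λ³x_μ²} ∪ {x_λ²x_μ^b : b ≥ 4}`, word `μ^∞`, deleting each `x_λ²x_μ^·` as it reaches `x_λ²x_μ`).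

THE THEOREM (**`no_infinite_play`**): there is no infinite play that is LEGAL at every time and carries BOTH
flags at every time.  Route (no certificate, no case tables): by finiteness of the initial support and the
pigeonhole principle the λ-flag is carried, at infinitely many times, by the trajectory of ONE initial
monomial (`exists_trajectory`), which is then present — hence legal — at all times.  For one legal
trajectory `(a_s, b_s)` with constants `c, e` (§1): the DEAD region `a + e ≥ c ∧ b + e ≥ c` is absorbing
(`dead_absorbing`); the DOUBLE-witness region `a + e < c ∧ b + e < c` is a trap in which `a + b` drops at
every legal step (`double_witness_dies`); hence once `b + e ≥ c` the trajectory is never a λ-witness again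
(`no_lambda_witness_after`); so a trajectory that is a λ-witness infinitely often lives in
`a + e ≥ c ∧ b + e < c` for ever (`lambda_witness_region`), where `a` never increases and drops at every
λ-step: **the word has at most `a₀` letters λ** (`lambda_count_add_le`, `finite_lambda_moves_of_trajectory`).
Symmetrically the μ-flag bounds the letters μ — and an infinite word cannot be finite in both letters.
In particular (the cases the model check saw): constant runs die by descent, and after a letter change
only finitely many steps remain.

bears_on: LADDER-RESOLUTION:D157-DOOR2 (res-dim4-pi · K2(p) · slice B · K24b-α).  Supports
stmt-ResolutionOfSingularities-16155 (helper).
-/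

set_option linter.dupNamespace false -- mandated namespace of this single-conjunct summit

namespace Summit.ResolutionOfSingularities.ResolutionOfSingularities.Theorems.PIDim4

namespace ResCone

namespace CInfGame

open Finset

/-! ## 1. One legal trajectory

A trajectory along the word `x` with constants `c, e`: `a (s+1) = a s + b s + e - c`, `b (s+1) = b s` at a
λ-step (`x s = true`), the mirror at a μ-step; LEGAL: `2c ≤ a s + 2 b s + 2e` at λ-steps,
`2c ≤ 2 a s + b s + 2e` at μ-steps. -/

section Trajectory

variable {x : ℕ → Bool} {c e : ℕ} {a b : ℕ → ℕ}

/-- The DEAD region `c ≤ a + e ∧ c ≤ b + e` is absorbing (no legality needed). [OURS] [folklore] -/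
theorem dead_absorbing
    (hL : ∀ s, x s = true → a (s + 1) = a s + b s + e - c ∧ b (s + 1) = b s)
    (hM : ∀ s, x s = false → a (s + 1) = a s ∧ b (s + 1) = a s + b s + e - c)
    {s : ℕ} (ha : c ≤ a s + e) (hb : c ≤ b s + e) (k : ℕ) :
    c ≤ a (s + k) + e ∧ c ≤ b (s + k) + e := by
  induction k with
  | zero => exact ⟨ha, hb⟩
  | succ k ih =>
    obtain ⟨ha', hb'⟩ := ih
    show c ≤ a (s + k + 1) + e ∧ c ≤ b (s + k + 1) + e
    cases hx : x (s + k) with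
    | false => obtain ⟨h1, h2⟩ := hM (s + k) hx; omega
    | true => obtain ⟨h1, h2⟩ := hL (s + k) hx; omega

/-- The DOUBLE-WITNESS region `a + e + 1 ≤ c ∧ b + e + 1 ≤ c` is a trap: a legal step keeps the trajectory
in it and lowers `a + b` (legality forces `a ≥ 2` at a λ-step, and the new `a` is `a − (c − b − e) ≤ a − 1`),
so no trajectory legal at all times is ever in it. [OURS] [folklore] -/
theorem double_witness_dies
    (hL : ∀ s, x s = true → a (s + 1) = a s + b s + e - c ∧ b (s + 1) = b s)
    (hM : ∀ s, x s = false → a (s + 1) = a s ∧ b (s + 1) = a s + b s + e - c)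
    (hlegL : ∀ s, x s = true → 2 * c ≤ a s + 2 * b s + 2 * e)
    (hlegM : ∀ s, x s = false → 2 * c ≤ 2 * a s + b s + 2 * e)
    {s : ℕ} (ha : a s + e + 1 ≤ c) (hb : b s + e + 1 ≤ c) : False := by
  have key : ∀ k, a (s + k) + e + 1 ≤ c ∧ b (s + k) + e + 1 ≤ c ∧
      a (s + k) + b (s + k) + k ≤ a s + b s := by
    intro k
    induction k with
    | zero => exact ⟨ha, hb, le_rfl⟩
    | succ k ih =>
      obtain ⟨h1, h2, h3⟩ := ih
      show a (s + k + 1) + e + 1 ≤ c ∧ b (s + k + 1) + e + 1 ≤ c ∧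
        a (s + k + 1) + b (s + k + 1) + (k + 1) ≤ a s + b s
      cases hx : x (s + k) with
      | false => obtain ⟨e1, e2⟩ := hM _ hx; have l := hlegM _ hx; omega
      | true => obtain ⟨e1, e2⟩ := hL _ hx; have l := hlegL _ hx; omega
  have := key (a s + b s + 1)
  omega

/-- Once `c ≤ b + e` (not a λ-witness), a trajectory legal at all times is NEVER a λ-witness again: λ-steps
keep `b`, μ-steps from the dead region stay dead, and a μ-step from `a + e < c ≤ b + e` either keeps
`c ≤ b + e` or enters the double-witness trap. [OURS] [folklore] -/
theorem no_lambda_witness_after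
    (hL : ∀ s, x s = true → a (s + 1) = a s + b s + e - c ∧ b (s + 1) = b s)
    (hM : ∀ s, x s = false → a (s + 1) = a s ∧ b (s + 1) = a s + b s + e - c)
    (hlegL : ∀ s, x s = true → 2 * c ≤ a s + 2 * b s + 2 * e)
    (hlegM : ∀ s, x s = false → 2 * c ≤ 2 * a s + b s + 2 * e)
    {s : ℕ} (hb : c ≤ b s + e) (k : ℕ) : c ≤ b (s + k) + e := by
  induction k with
  | zero => exact hb
  | succ k ih =>
    show c ≤ b (s + k + 1) + e
    cases hx : x (s + k) with
    | true => obtain ⟨e1, e2⟩ := hL _ hx; omega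
    | false =>
      obtain ⟨e1, e2⟩ := hM _ hx
      by_contra hcon
      by_cases hak : c ≤ a (s + k) + e
      · omega
      · exact double_witness_dies hL hM hlegL hlegM (s := s + k + 1) (by omega) (by omega)

/-- A trajectory legal at all times which is a λ-witness at arbitrarily late times lives in the region
`c ≤ a + e ∧ b + e + 1 ≤ c` at EVERY time. [OURS] [folklore] -/
theorem lambda_witness_region
    (hL : ∀ s, x s = true → a (s + 1) = a s + b s + e - c ∧ b (s + 1) = b s)
    (hM : ∀ s, x s = false → a (s + 1) = a s ∧ b (s + 1) = a s + b s + e - c)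
    (hlegL : ∀ s, x s = true → 2 * c ≤ a s + 2 * b s + 2 * e)
    (hlegM : ∀ s, x s = false → 2 * c ≤ 2 * a s + b s + 2 * e)
    (hwit : ∀ N, ∃ t, N ≤ t ∧ b t + e + 1 ≤ c) (s : ℕ) :
    c ≤ a s + e ∧ b s + e + 1 ≤ c := by
  have hbs : b s + e + 1 ≤ c := by
    by_contra h
    obtain ⟨t, hst, hbt⟩ := hwit s
    obtain ⟨k, rfl⟩ := Nat.exists_eq_add_of_le hst
    have := no_lambda_witness_after hL hM hlegL hlegM (s := s) (by omega) k
    omega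
  refine ⟨?_, hbs⟩
  by_contra h
  exact double_witness_dies hL hM hlegL hlegM (s := s) (by omega) hbs

/-- **Descent**: along such a trajectory `a` never increases and drops at every λ-step, so
`#{s < t : x s = λ} + a t ≤ a 0`. [OURS] [folklore] -/
theorem lambda_count_add_le
    (hL : ∀ s, x s = true → a (s + 1) = a s + b s + e - c ∧ b (s + 1) = b s)
    (hM : ∀ s, x s = false → a (s + 1) = a s ∧ b (s + 1) = a s + b s + e - c)
    (hlegL : ∀ s, x s = true → 2 * c ≤ a s + 2 * b s + 2 * e)
    (hlegM : ∀ s, x s = false → 2 * c ≤ 2 * a s + b s + 2 * e)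
    (hwit : ∀ N, ∃ t, N ≤ t ∧ b t + e + 1 ≤ c) (t : ℕ) :
    (∑ s ∈ range t, (x s).toNat) + a t ≤ a 0 := by
  induction t with
  | zero => simp
  | succ t ih =>
    rw [sum_range_succ]
    obtain ⟨hat, hbt⟩ := lambda_witness_region hL hM hlegL hlegM hwit t
    cases hx : x t with
    | false => obtain ⟨e1, e2⟩ := hM t hx; simp only [Bool.toNat_false]; omega
    | true => obtain ⟨e1, e2⟩ := hL t hx; simp only [Bool.toNat_true]; omega

/-- **The λ-flag bounds the letters λ**: a trajectory legal at all times and a λ-witness at arbitrarily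
late times forces the word to have only finitely many (indeed `≤ a 0`) letters λ. [OURS] [folklore] -/
theorem finite_lambda_moves_of_trajectory
    (hL : ∀ s, x s = true → a (s + 1) = a s + b s + e - c ∧ b (s + 1) = b s)
    (hM : ∀ s, x s = false → a (s + 1) = a s ∧ b (s + 1) = a s + b s + e - c)
    (hlegL : ∀ s, x s = true → 2 * c ≤ a s + 2 * b s + 2 * e)
    (hlegM : ∀ s, x s = false → 2 * c ≤ 2 * a s + b s + 2 * e)
    (hwit : ∀ N, ∃ t, N ≤ t ∧ b t + e + 1 ≤ c) : Set.Finite {s | x s = true} := by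
  by_contra hinf
  have hinf' : Set.Infinite {s | x s = true} := hinf
  obtain ⟨S, hSsub, hScard⟩ := hinf'.exists_subset_card_eq (a 0 + 1)
  have hcount := lambda_count_add_le hL hM hlegL hlegM hwit (S.sup id + 1)
  have hle : S.card ≤ ∑ s ∈ range (S.sup id + 1), (x s).toNat :=
    calc S.card = ∑ s ∈ S, 1 := by simp
      _ = ∑ s ∈ S, (x s).toNat := sum_congr rfl fun s hs => by
            have hxs : x s = true := hSsub (mem_coe.mpr hs)
            simp [hxs]
      _ ≤ ∑ s ∈ range (S.sup id + 1), (x s).toNat :=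
            sum_le_sum_of_subset fun s hs => mem_range.mpr (Nat.lt_succ_of_le (le_sup (f := id) hs))
  omega

/-- The mirror: **the μ-flag bounds the letters μ** (swap `a ↔ b` and the letters). [OURS] [folklore] -/
theorem finite_mu_moves_of_trajectory
    (hL : ∀ s, x s = true → a (s + 1) = a s + b s + e - c ∧ b (s + 1) = b s)
    (hM : ∀ s, x s = false → a (s + 1) = a s ∧ b (s + 1) = a s + b s + e - c)
    (hlegL : ∀ s, x s = true → 2 * c ≤ a s + 2 * b s + 2 * e)
    (hlegM : ∀ s, x s = false → 2 * c ≤ 2 * a s + b s + 2 * e)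
    (hwit : ∀ N, ∃ t, N ≤ t ∧ a t + e + 1 ≤ c) : Set.Finite {s | x s = false} := by
  have hL' : ∀ s, (!x s) = true → b (s + 1) = b s + a s + e - c ∧ a (s + 1) = a s := fun s hs => by
    have hx : x s = false := by simpa using hs
    exact ⟨by rw [(hM s hx).2, Nat.add_comm (a s) (b s)], (hM s hx).1⟩
  have hM' : ∀ s, (!x s) = false → b (s + 1) = b s ∧ a (s + 1) = b s + a s + e - c := fun s hs => by
    have hx : x s = true := by simpa using hs
    exact ⟨(hL s hx).2, by rw [(hL s hx).1, Nat.add_comm (a s) (b s)]⟩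
  have hlegL' : ∀ s, (!x s) = true → 2 * c ≤ b s + 2 * a s + 2 * e := fun s hs => by
    have hx : x s = false := by simpa using hs
    have := hlegM s hx; omega
  have hlegM' : ∀ s, (!x s) = false → 2 * c ≤ 2 * b s + a s + 2 * e := fun s hs => by
    have hx : x s = true := by simpa using hs
    have := hlegL s hx; omega
  have h := finite_lambda_moves_of_trajectory (x := fun s => !x s) hL' hM' hlegL' hlegM' hwit
  simpa using h

end Trajectory

/-! ## 2. Plays: extraction of a trajectory and the theorem -/

/-- **Trajectory extraction** (finite initial support + pigeonhole).  In a play `P` along the word `x` from a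
finite support `F`, in which every monomial present at time `t + 1` is the `x t`-image of one present at
time `t` or is born dead, a property `Q` of LIVE monomials flagged at EVERY time is carried at ARBITRARILY
LATE times by the trajectory of one initial monomial; that trajectory is present in the play at all times
(dead is forward-absorbing, so the backward chain of a live monomial consists of images). [OURS] [folklore] -/
theorem exists_trajectory (x : ℕ → Bool) (P : ℕ → ℕ × ℕ × ℕ × ℕ → Prop) (F : Finset (ℕ × ℕ × ℕ × ℕ))
    (Q : ℕ × ℕ × ℕ × ℕ → Prop) (hQ : ∀ m, Q m → ¬ (m.1 ≤ m.2.1 + m.2.2.2 ∧ m.1 ≤ m.2.2.1 + m.2.2.2))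
    (hF : ∀ m, P 0 m → m ∈ F)
    (hevol : ∀ t m, P (t + 1) m → (∃ m', P t m' ∧
      m = if x t = true then (m'.1, m'.2.1 + m'.2.2.1 + m'.2.2.2 - m'.1, m'.2.2.1, m'.2.2.2)
        else (m'.1, m'.2.1, m'.2.1 + m'.2.2.1 + m'.2.2.2 - m'.1, m'.2.2.2)) ∨
      (m.1 ≤ m.2.1 + m.2.2.2 ∧ m.1 ≤ m.2.2.1 + m.2.2.2))
    (hflag : ∀ t, ∃ m, P t m ∧ Q m) :
    ∃ (c e : ℕ) (a b : ℕ → ℕ), (∀ s, P s (c, a s, b s, e)) ∧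
      (∀ s, x s = true → a (s + 1) = a s + b s + e - c ∧ b (s + 1) = b s) ∧
      (∀ s, x s = false → a (s + 1) = a s ∧ b (s + 1) = a s + b s + e - c) ∧
      (∀ N, ∃ t, N ≤ t ∧ Q (c, a t, b t, e)) := by
  classical
  -- the step maps and the trajectory of an initial monomial
  let step : ℕ → ℕ × ℕ × ℕ × ℕ → ℕ × ℕ × ℕ × ℕ := fun t m' =>
    if x t = true then (m'.1, m'.2.1 + m'.2.2.1 + m'.2.2.2 - m'.1, m'.2.2.1, m'.2.2.2)
    else (m'.1, m'.2.1, m'.2.1 + m'.2.2.1 + m'.2.2.2 - m'.1, m'.2.2.2)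
  let traj : ℕ × ℕ × ℕ × ℕ → ℕ → ℕ × ℕ × ℕ × ℕ := fun m₀ n =>
    Nat.rec (motive := fun _ => ℕ × ℕ × ℕ × ℕ) m₀ (fun s m => step s m) n
  have traj_succ : ∀ m₀ s, traj m₀ (s + 1) = step s (traj m₀ s) := fun _ _ => rfl
  -- a DEAD monomial (`c ≤ a + e ∧ c ≤ b + e`) has a dead image
  have hdead : ∀ t (m' : ℕ × ℕ × ℕ × ℕ), m'.1 ≤ m'.2.1 + m'.2.2.2 ∧ m'.1 ≤ m'.2.2.1 + m'.2.2.2 →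
      (step t m').1 ≤ (step t m').2.1 + (step t m').2.2.2 ∧
        (step t m').1 ≤ (step t m').2.2.1 + (step t m').2.2.2 := by
    intro t m' h
    cases hx : x t with
    | false => simp only [step, hx, Bool.false_eq_true, ite_false]; omega
    | true => simp only [step, hx, ite_true]; omega
  -- every LIVE monomial present at time `t` ends a trajectory lying in the play
  have hback : ∀ t m, P t m → ¬ (m.1 ≤ m.2.1 + m.2.2.2 ∧ m.1 ≤ m.2.2.1 + m.2.2.2) →
      ∃ m₀ ∈ F, traj m₀ t = m ∧ ∀ s, s ≤ t → P s (traj m₀ s) := by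
    intro t
    induction t with
    | zero =>
      intro m hm _
      refine ⟨m, hF m hm, rfl, fun s hs => ?_⟩
      rw [Nat.le_zero.mp hs]; exact hm
    | succ t ih =>
      intro m hm hlive
      obtain ⟨m', hm', hmeq⟩ := (hevol t m hm).resolve_right hlive
      have hst : step t m' = m := hmeq.symm
      have hlive' : ¬ (m'.1 ≤ m'.2.1 + m'.2.2.2 ∧ m'.1 ≤ m'.2.2.1 + m'.2.2.2) := fun h =>
        hlive (by rw [← hst]; exact hdead t m' h)
      obtain ⟨m₀, hm₀, htr, hpath⟩ := ih m' hm' hlive'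
      refine ⟨m₀, hm₀, by rw [traj_succ, htr, hst], fun s hs => ?_⟩
      rcases Nat.lt_or_ge s (t + 1) with h | h
      · exact hpath s (by omega)
      · obtain rfl : s = t + 1 := le_antisymm hs h
        rw [traj_succ, htr, hst]; exact hm
  -- the flag carriers, their origins, and an origin hit infinitely often
  choose w hw using hflag
  choose g hg using fun t => hback t (w t) (hw t).1 (hQ _ (hw t).2)
  obtain ⟨y, hy⟩ := Finite.exists_infinite_fiber (fun t : ℕ => (⟨g t, (hg t).1⟩ : F))
  have hT : Set.Infinite ((fun t : ℕ => (⟨g t, (hg t).1⟩ : F)) ⁻¹' {y}) := Set.infinite_coe_iff.mp hy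
  have hio : ∀ N, ∃ t, N ≤ t ∧ g t = (y : ℕ × ℕ × ℕ × ℕ) := by
    intro N
    obtain ⟨t, ht, hNt⟩ := hT.exists_gt N
    have hty : (⟨g t, (hg t).1⟩ : F) = y := ht
    exact ⟨t, hNt.le, by simpa using congrArg Subtype.val hty⟩
  -- the trajectory of that origin is present at all times; its constants
  have hP : ∀ s, P s (traj y s) := by
    intro s
    obtain ⟨t, hst, hgt⟩ := hio s
    have := (hg t).2.2 s hst
    rwa [hgt] at this
  have hce : ∀ s, (traj y s).1 = (y : ℕ × ℕ × ℕ × ℕ).1 ∧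
      (traj y s).2.2.2 = (y : ℕ × ℕ × ℕ × ℕ).2.2.2 := by
    intro s
    induction s with
    | zero => exact ⟨rfl, rfl⟩
    | succ s ih =>
      rw [traj_succ]
      cases hx : x s with
      | false => simpa [step, hx] using ih
      | true => simpa [step, hx] using ih
  have hsplit : ∀ s, traj y s =
      ((y : ℕ × ℕ × ℕ × ℕ).1, (traj y s).2.1, (traj y s).2.2.1, (y : ℕ × ℕ × ℕ × ℕ).2.2.2) := by
    intro s
    obtain ⟨h1, h4⟩ := hce s
    ext <;> simp [h1, h4]
  refine ⟨(y : ℕ × ℕ × ℕ × ℕ).1, (y : ℕ × ℕ × ℕ × ℕ).2.2.2, fun s => (traj y s).2.1,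
    fun s => (traj y s).2.2.1, fun s => ?_, fun s hx => ?_, fun s hx => ?_, fun N => ?_⟩
  · have h := hP s
    rw [hsplit s] at h
    exact h
  · obtain ⟨h1, h4⟩ := hce s
    show (traj y (s + 1)).2.1 = _ ∧ (traj y (s + 1)).2.2.1 = _
    rw [traj_succ]
    simp [step, hx, h1, h4]
  · obtain ⟨h1, h4⟩ := hce s
    show (traj y (s + 1)).2.1 = _ ∧ (traj y (s + 1)).2.2.1 = _
    rw [traj_succ]
    simp [step, hx, h1, h4]
  · obtain ⟨t, hNt, hgt⟩ := hio N
    refine ⟨t, hNt, ?_⟩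
    have h2 := (hg t).2.1
    rw [hgt] at h2
    have hQ := (hw t).2
    rw [← h2, hsplit t] at hQ
    exact hQ

/-- **The λ-flag bounds the letters λ of a play.**  A play along `x` from a finite support, LEGAL at every
time for the letter played and carrying the λ-FLAG (a monomial with `b + e + 1 ≤ c`) at every time, has only
finitely many letters λ.  (For the constant word λ this is «no infinite λ-run»: every λ-witness descends to
a blocker.) [OURS] [folklore] -/
theorem finite_lambda_moves (x : ℕ → Bool) (P : ℕ → ℕ × ℕ × ℕ × ℕ → Prop) (F : Finset (ℕ × ℕ × ℕ × ℕ))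
    (hF : ∀ m, P 0 m → m ∈ F)
    (hevol : ∀ t m, P (t + 1) m → (∃ m', P t m' ∧
      m = if x t = true then (m'.1, m'.2.1 + m'.2.2.1 + m'.2.2.2 - m'.1, m'.2.2.1, m'.2.2.2)
        else (m'.1, m'.2.1, m'.2.1 + m'.2.2.1 + m'.2.2.2 - m'.1, m'.2.2.2)) ∨
      (m.1 ≤ m.2.1 + m.2.2.2 ∧ m.1 ≤ m.2.2.1 + m.2.2.2))
    (hlegL : ∀ t m, P t m → x t = true → 2 * m.1 ≤ m.2.1 + 2 * m.2.2.1 + 2 * m.2.2.2)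
    (hlegM : ∀ t m, P t m → x t = false → 2 * m.1 ≤ 2 * m.2.1 + m.2.2.1 + 2 * m.2.2.2)
    (hflag : ∀ t, ∃ m, P t m ∧ m.2.2.1 + m.2.2.2 + 1 ≤ m.1) : Set.Finite {t | x t = true} := by
  obtain ⟨c, e, a, b, hP, hL, hM, hio⟩ :=
    exists_trajectory x P F (fun m => m.2.2.1 + m.2.2.2 + 1 ≤ m.1) (fun m h => by omega) hF hevol hflag
  exact finite_lambda_moves_of_trajectory hL hM (fun s hx => hlegL s _ (hP s) hx)
    (fun s hx => hlegM s _ (hP s) hx) hio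

/-- **The μ-flag bounds the letters μ of a play** (mirror of `finite_lambda_moves`). [OURS] [folklore] -/
theorem finite_mu_moves (x : ℕ → Bool) (P : ℕ → ℕ × ℕ × ℕ × ℕ → Prop) (F : Finset (ℕ × ℕ × ℕ × ℕ))
    (hF : ∀ m, P 0 m → m ∈ F)
    (hevol : ∀ t m, P (t + 1) m → (∃ m', P t m' ∧
      m = if x t = true then (m'.1, m'.2.1 + m'.2.2.1 + m'.2.2.2 - m'.1, m'.2.2.1, m'.2.2.2)
        else (m'.1, m'.2.1, m'.2.1 + m'.2.2.1 + m'.2.2.2 - m'.1, m'.2.2.2)) ∨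
      (m.1 ≤ m.2.1 + m.2.2.2 ∧ m.1 ≤ m.2.2.1 + m.2.2.2))
    (hlegL : ∀ t m, P t m → x t = true → 2 * m.1 ≤ m.2.1 + 2 * m.2.2.1 + 2 * m.2.2.2)
    (hlegM : ∀ t m, P t m → x t = false → 2 * m.1 ≤ 2 * m.2.1 + m.2.2.1 + 2 * m.2.2.2)
    (hflag : ∀ t, ∃ m, P t m ∧ m.2.1 + m.2.2.2 + 1 ≤ m.1) : Set.Finite {t | x t = false} := by
  obtain ⟨c, e, a, b, hP, hL, hM, hio⟩ :=
    exists_trajectory x P F (fun m => m.2.1 + m.2.2.2 + 1 ≤ m.1) (fun m h => by omega) hF hevol hflag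
  exact finite_mu_moves_of_trajectory hL hM (fun s hx => hlegL s _ (hP s) hx)
    (fun s hx => hlegM s _ (hP s) hx) hio

/-- **THE C∞ GAME HAS NO INFINITE LEGAL DOUBLY-FLAGGED PLAY.**  Along any word `x : ℕ → Bool` (`true = λ`),
a play `P` from a FINITE support `F` (frame obligation, see the module docstring; every monomial at time
`t + 1` the `x t`-image of one at time `t`, or born dead `c ≤ a + e ∧ c ≤ b + e`),
LEGAL at every time (`2c ≤ a + 2b + 2e` for everybody at λ-steps, `2c ≤ 2a + b + 2e` at μ-steps) cannot
carry both the λ-FLAG (`b + e + 1 ≤ c` for somebody) and the μ-FLAG (`a + e + 1 ≤ c` for somebody) at every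
time: the λ-flag makes the letters λ finite, the μ-flag the letters μ. [OURS] [folklore] -/
theorem no_infinite_play (x : ℕ → Bool) (P : ℕ → ℕ × ℕ × ℕ × ℕ → Prop) (F : Finset (ℕ × ℕ × ℕ × ℕ))
    (hF : ∀ m, P 0 m → m ∈ F)
    (hevol : ∀ t m, P (t + 1) m → (∃ m', P t m' ∧
      m = if x t = true then (m'.1, m'.2.1 + m'.2.2.1 + m'.2.2.2 - m'.1, m'.2.2.1, m'.2.2.2)
        else (m'.1, m'.2.1, m'.2.1 + m'.2.2.1 + m'.2.2.2 - m'.1, m'.2.2.2)) ∨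
      (m.1 ≤ m.2.1 + m.2.2.2 ∧ m.1 ≤ m.2.2.1 + m.2.2.2))
    (hlegL : ∀ t m, P t m → x t = true → 2 * m.1 ≤ m.2.1 + 2 * m.2.2.1 + 2 * m.2.2.2)
    (hlegM : ∀ t m, P t m → x t = false → 2 * m.1 ≤ 2 * m.2.1 + m.2.2.1 + 2 * m.2.2.2)
    (hflagL : ∀ t, ∃ m, P t m ∧ m.2.2.1 + m.2.2.2 + 1 ≤ m.1)
    (hflagM : ∀ t, ∃ m, P t m ∧ m.2.1 + m.2.2.2 + 1 ≤ m.1) : False := by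
  have h := (finite_lambda_moves x P F hF hevol hlegL hlegM hflagL).union
    (finite_mu_moves x P F hF hevol hlegL hlegM hflagM)
  refine Set.infinite_univ (α := ℕ) (h.subset fun t _ => ?_)
  cases hx : x t with
  | false => exact Or.inr hx
  | true => exact Or.inl hx

end CInfGame

end ResCone

end Summit.ResolutionOfSingularities.ResolutionOfSingularities.Theorems.PIDim4
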